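import Literature.NumberTheory.LFunctions.WeilMarkovQuadratic
import Literature.NumberTheory.LFunctions.WeilGroundState
import Literature.NumberTheory.LFunctions.WeilWindowSuzukiProofs
import Literature.NumberTheory.LFunctions.WeilWindowSuzukiAsymptoticProofs
import Mathlib.Analysis.Convolution
import Mathlib.Analysis.SpecialFunctions.Integrals.Basic

/-!
# Auxiliary lemmas for stub `stub_supBound`
(line `cut-dont-squeeze`, crux `WeilWindowFlow.WindowLipschitz`)

Infrastructure for the `L^∞` bound on Weil ground states (maximum principle by the
`δ`-decomposition of Feulefack–Jarohs–Weth, arXiv:2010.10448 §3):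

* measurability in the lag `t` of increments `∫ (u(x+t) − u(x)) conj(w(x+t) − w(x)) dx`
  (product measurability + `AEStronglyMeasurable.integral_prod_right'`);
* the far-field swap `∫_t ∫_x f(x) g(x+t) dx dt = (∫ f)(∫ g)` (Mathlib's `integral_convolution`)
  and the resulting bound `∫_{t>δ} ρ(t) ∫ f(x) g(x+t) dx dt ≤ ρ(δ) ‖f‖₁ ‖g‖₁`;
* the choice of the near/far threshold `δ` with `2∫_{Ioi δ} ρ ≥ R` (`ρ(t) ≥ 1/(4t)` on `(0,1]`);
* monotonicity of the killing constant `M_a` and antitonicity of the ground energy `ε(a)`.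

## References

* P. A. Feulefack, S. Jarohs, T. Weth, *Small order asymptotics of the Dirichlet eigenvalue
  problem for the fractional Laplacian*, J. Fourier Anal. Appl. 28 (2022), arXiv:2010.10448, §3.
-/

set_option linter.dupNamespace false

noncomputable section

open MeasureTheory Set Filter
open scoped Topology ENNReal NNReal ComplexConjugate Convolution

namespace Summit.RiemannHypothesis.RiemannHypothesis.Theorems.WeilWindowFlowWindowLipschitz

open Literature.NumberTheory.LFunctions

/-! ## Measurability in the lag variable -/

/-- For a.e.-strongly measurable `u`, the map `(t, x) ↦ u (x + t)` is a.e.-strongly measurable on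
`ℝ × ℝ` (the shear `(t, x) ↦ x + t` is quasi-measure-preserving). [folklore] -/
theorem stub_supBound_aesm_shear {u : ℝ → ℂ} (hu : AEStronglyMeasurable u volume) :
    AEStronglyMeasurable (fun p : ℝ × ℝ ↦ u (p.2 + p.1)) (volume.prod volume) :=
  hu.comp_quasiMeasurePreserving (quasiMeasurePreserving_add_swap volume volume)

/-- **Measurability of cross increments in the lag.** For a.e.-strongly measurable `u w : ℝ → ℂ`,
`t ↦ ∫ (u(x+t) − u(x)) conj(w(x+t) − w(x)) dx` is a.e.-strongly measurable. [folklore] -/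
theorem stub_supBound_aesm_crossIncrement {u w : ℝ → ℂ} (hu : AEStronglyMeasurable u volume)
    (hw : AEStronglyMeasurable w volume) :
    AEStronglyMeasurable
      (fun t : ℝ ↦ ∫ x : ℝ, (u (x + t) - u x) * conj (w (x + t) - w x)) volume := by
  have h : AEStronglyMeasurable (fun p : ℝ × ℝ ↦
      (u (p.2 + p.1) - u p.2) * conj (w (p.2 + p.1) - w p.2)) (volume.prod volume) :=
    ((stub_supBound_aesm_shear hu).sub hu.comp_snd).mul
      (Complex.continuous_conj.comp_aestronglyMeasurable
        ((stub_supBound_aesm_shear hw).sub hw.comp_snd))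
  exact h.integral_prod_right'

/-- **Measurability of the increment form in the lag.** For a.e.-strongly measurable `w`,
`t ↦ D_t(w) = ∫ ‖w(x+t) − w(x)‖² dx` is a.e.-strongly measurable. [folklore] -/
theorem stub_supBound_aesm_weilIncrement {w : ℝ → ℂ} (hw : AEStronglyMeasurable w volume) :
    AEStronglyMeasurable (weilIncrement w) volume := by
  have h : AEStronglyMeasurable (fun p : ℝ × ℝ ↦ ‖w (p.2 + p.1) - w p.2‖ ^ 2)
      (volume.prod volume) :=
    (continuous_pow 2).comp_aestronglyMeasurable
      ((stub_supBound_aesm_shear hw).sub hw.comp_snd).norm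
  exact h.integral_prod_right'

/-! ## The far-field swap (convolution) -/

/-- `((f ∘ neg) ⋆ g)(t) = ∫ f(x) g(x + t) dx`. [folklore] -/
theorem stub_supBound_conv_apply (f g : ℝ → ℝ) (t : ℝ) :
    ((fun x ↦ f (-x)) ⋆[ContinuousLinearMap.mul ℝ ℝ, volume] g) t = ∫ x, f x * g (x + t) := by
  rw [convolution_def, ← integral_neg_eq_self _ volume]
  simp only [ContinuousLinearMap.mul_apply', neg_neg, sub_neg_eq_add]
  congr 1 with x
  rw [add_comm]

/-- `t ↦ ∫ f(x) g(x + t) dx` is integrable for integrable `f, g`. [folklore] -/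
theorem stub_supBound_integrable_conv {f g : ℝ → ℝ} (hf : Integrable f) (hg : Integrable g) :
    Integrable (fun t ↦ ∫ x, f x * g (x + t)) := by
  have h := hf.comp_neg.integrable_convolution (ContinuousLinearMap.mul ℝ ℝ) hg
  refine h.congr (Eventually.of_forall fun t ↦ ?_)
  exact stub_supBound_conv_apply f g t

/-- **The swap**: `∫_t ∫_x f(x) g(x + t) dx dt = (∫ f)(∫ g)` for integrable `f, g`. [folklore] -/
theorem stub_supBound_integral_conv {f g : ℝ → ℝ} (hf : Integrable f) (hg : Integrable g) :
    ∫ t, ∫ x, f x * g (x + t) = (∫ x, f x) * ∫ x, g x := by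
  have h := integral_convolution (L := ContinuousLinearMap.mul ℝ ℝ) (μ := volume) (ν := volume)
    hf.comp_neg hg
  simp only [stub_supBound_conv_apply, ContinuousLinearMap.mul_apply'] at h
  rwa [integral_neg_eq_self _ volume] at h

/-- **Far-field bound.** For integrable `f, g` and `δ > 0`:
`∫_{t > δ} ρ(t) (∫ f(x) g(x+t) dx) dt ≤ ρ(δ) ‖f‖₁ ‖g‖₁` (`ρ` is non-increasing, then the swap).
[folklore] -/
theorem stub_supBound_far_bound {f g : ℝ → ℝ} (hf : Integrable f) (hg : Integrable g) {δ : ℝ}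
    (hδ : 0 < δ) :
    ∫ t in Ioi δ, weilArchDensity t * ∫ x, f x * g (x + t) ≤
      weilArchDensity δ * ((∫ x, |f x|) * ∫ x, |g x|) := by
  set F : ℝ → ℝ := fun t ↦ ∫ x, |f x| * |g (x + t)| with hF
  have hFi : Integrable F := stub_supBound_integrable_conv hf.abs hg.abs
  have hFint : ∫ t, F t = (∫ x, |f x|) * ∫ x, |g x| := stub_supBound_integral_conv hf.abs hg.abs
  have hF0 : ∀ t, 0 ≤ F t := fun t ↦
    integral_nonneg fun x ↦ mul_nonneg (abs_nonneg _) (abs_nonneg _)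
  have hJF : ∀ t, ∫ x, f x * g (x + t) ≤ F t := fun t ↦ by
    refine (le_abs_self _).trans ((abs_integral_le_integral_abs).trans_eq ?_)
    simp only [hF, abs_mul]
  have hJi : Integrable (fun t ↦ ∫ x, f x * g (x + t)) := stub_supBound_integrable_conv hf hg
  have hρb : ∀ᵐ t ∂(volume.restrict (Ioi δ)), ‖weilArchDensity t‖ ≤ weilArchDensity δ := by
    refine (ae_restrict_iff' measurableSet_Ioi).2 (Eventually.of_forall fun t (ht : δ < t) ↦ ?_)
    rw [Real.norm_of_nonneg (weilArchDensity_pos (hδ.trans ht)).le]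
    exact weilArchDensity_antitoneOn (mem_Ioi.2 hδ) (mem_Ioi.2 (hδ.trans ht)) ht.le
  have h1 : IntegrableOn (fun t ↦ weilArchDensity t * ∫ x, f x * g (x + t)) (Ioi δ) :=
    hJi.integrableOn.bdd_mul measurable_weilArchDensity.aestronglyMeasurable hρb
  calc ∫ t in Ioi δ, weilArchDensity t * ∫ x, f x * g (x + t)
      ≤ ∫ t in Ioi δ, weilArchDensity δ * F t := by
        refine setIntegral_mono_on h1 (hFi.const_mul _).integrableOn measurableSet_Ioi
          fun t (ht : δ < t) ↦ ?_
        calc weilArchDensity t * ∫ x, f x * g (x + t) ≤ weilArchDensity t * F t :=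
              mul_le_mul_of_nonneg_left (hJF t) (weilArchDensity_pos (hδ.trans ht)).le
          _ ≤ weilArchDensity δ * F t :=
              mul_le_mul_of_nonneg_right
                (weilArchDensity_antitoneOn (mem_Ioi.2 hδ) (mem_Ioi.2 (hδ.trans ht)) ht.le) (hF0 t)
    _ ≤ ∫ t, weilArchDensity δ * F t :=
        setIntegral_le_integral (hFi.const_mul _)
          (Eventually.of_forall fun t ↦ mul_nonneg (weilArchDensity_pos hδ).le (hF0 t))
    _ = weilArchDensity δ * ((∫ x, |f x|) * ∫ x, |g x|) := by rw [integral_const_mul, hFint]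

/-! ## The near/far threshold -/

/-- **Choice of `δ`.** For every `R` there is `δ > 0` with `2∫_{Ioi δ} ρ ≥ R`
(`ρ(t) ≥ e^{-t/2}/(2t) ≥ 1/(4t)` on `(0, 1]` and `∫_δ^1 dt/t = log(1/δ)`). [folklore] -/
theorem stub_supBound_exists_delta :
    ∀ R : ℝ, ∃ δ : ℝ, 0 < δ ∧ R ≤ 2 * ∫ t in Ioi δ, weilArchDensity t := by
  intro R
  set R' : ℝ := max R 0 with hR'
  have hR'0 : 0 ≤ R' := le_max_right _ _
  set δ : ℝ := Real.exp (-(2 * R')) with hδ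
  have hδ0 : 0 < δ := Real.exp_pos _
  have hδ1 : δ ≤ 1 := Real.exp_le_one_iff.2 (by linarith)
  refine ⟨δ, hδ0, ?_⟩
  have hlow : ∀ t ∈ Ioc δ 1, 1 / (4 * t) ≤ weilArchDensity t := by
    intro t ht
    have ht0 : 0 < t := hδ0.trans ht.1
    refine le_trans ?_ (exp_neg_half_div_le_weilArchDensity ht0)
    have h := Real.add_one_le_exp (-(t / 2))
    rw [div_le_div_iff₀ (by positivity) (by positivity)]
    nlinarith [ht.2]
  have hint : ∫ t in Ioc δ 1, 1 / (4 * t) = R' / 2 := by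
    rw [← intervalIntegral.integral_of_le hδ1]
    have e : (fun t : ℝ ↦ 1 / (4 * t)) = fun t ↦ (1 / 4) * t⁻¹ := by
      funext t
      ring
    rw [e, intervalIntegral.integral_const_mul, integral_inv_of_pos hδ0 one_pos]
    simp only [one_div, Real.log_inv, hδ, Real.log_exp]
    ring
  have hIoi : IntegrableOn weilArchDensity (Ioi δ) := integrableOn_weilArchDensity_Ioi hδ0
  have hcont : ContinuousOn (fun t : ℝ ↦ 1 / (4 * t)) (Icc δ 1) :=
    continuousOn_const.div (continuousOn_const.mul continuousOn_id)
      fun t ht ↦ by have : 0 < t := hδ0.trans_le ht.1; positivity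
  calc R ≤ R' := le_max_left _ _
    _ = 2 * ∫ t in Ioc δ 1, 1 / (4 * t) := by rw [hint]; ring
    _ ≤ 2 * ∫ t in Ioc δ 1, weilArchDensity t :=
        mul_le_mul_of_nonneg_left (setIntegral_mono_on
          ((hcont.integrableOn_Icc).mono_set Ioc_subset_Icc_self)
          (hIoi.mono_set Ioc_subset_Ioi_self) measurableSet_Ioc hlow) two_pos.le
    _ ≤ 2 * ∫ t in Ioi δ, weilArchDensity t :=
        mul_le_mul_of_nonneg_left (setIntegral_mono_set hIoi
          ((ae_restrict_iff' measurableSet_Ioi).2 (Eventually.of_forall fun t ht ↦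
            (weilArchDensity_pos (hδ0.trans ht)).le))
          Ioc_subset_Ioi_self.eventuallyLE) two_pos.le

/-! ## Monotonicity of the window constants -/

/-- `weilPrimeIndex` is monotone in the window. [folklore] -/
theorem stub_supBound_weilPrimeIndex_mono {a b : ℝ} (hab : a ≤ b) :
    weilPrimeIndex a ⊆ weilPrimeIndex b := fun _ hn ↦
  mem_weilPrimeIndex.2 ((mem_weilPrimeIndex.1 hn).trans_le (by linarith))

/-- The killing constant `M_a` is monotone in `a`. [folklore] -/
theorem stub_supBound_weilMarkovConstant_mono {a b : ℝ} (hab : a ≤ b) :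
    weilMarkovConstant a ≤ weilMarkovConstant b := by
  unfold weilMarkovConstant
  have h := Finset.sum_le_sum_of_subset_of_nonneg
    (f := fun n : ℕ ↦ (ArithmeticFunction.vonMangoldt n : ℝ) / Real.sqrt n)
    (stub_supBound_weilPrimeIndex_mono hab)
    (fun n _ _ ↦ div_nonneg ArithmeticFunction.vonMangoldt_nonneg (Real.sqrt_nonneg _))
  linarith

/-- The ground energy is antitone in the window: `ε(a) ≤ ε(b)` for `0 < b ≤ a` (the sphere of the
smaller window is contained in that of the larger). [folklore] -/
theorem stub_supBound_weilGroundEnergy_anti {a b : ℝ} (hb : 0 < b) (hba : b ≤ a) :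
    weilGroundEnergy a ≤ weilGroundEnergy b := by
  obtain ⟨g, hg, hs, hn⟩ := exists_isWeilTest_sphere hb
  refine le_csInf ⟨_, g, hg, hs, hn, rfl⟩ ?_
  rintro x ⟨h, hh, hhs, hhn, rfl⟩
  exact csInf_le (bddBelow_weilQuadratic_sphere_holds a)
    ⟨h, hh, hhs.trans (Icc_subset_Icc (neg_le_neg hba) hba), hhn, rfl⟩

/-! ## Real parts of the pairings against a real test function -/

/-- `Re ∫ f · conj(W) = ∫ (Re f) · W` for real `W` (integrable product). [folklore] -/
theorem stub_supBound_re_integral_mul_conj_ofReal {f : ℝ → ℂ} {W : ℝ → ℝ}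
    (hint : Integrable (fun x ↦ f x * (W x : ℂ))) :
    (∫ x, f x * conj ((W x : ℂ))).re = ∫ x, (f x).re * W x := by
  simp only [Complex.conj_ofReal]
  have h := integral_re hint
  simp only [RCLike.re_to_complex, Complex.re_mul_ofReal] at h
  exact h.symm

/-- **Real part of a cross increment against a real test function**:
`Re ∫ (u(x+t) − u(x)) conj(W(x+t) − W(x)) dx = ∫ (Re u(x+t) − Re u(x)) (W(x+t) − W(x)) dx`
for `u, W ∈ L²`. [folklore] -/
theorem stub_supBound_re_crossIncrement {u : ℝ → ℂ} {W : ℝ → ℝ} (hu : MemLp u 2)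
    (hW : MemLp (fun x ↦ (W x : ℂ)) 2) (t : ℝ) :
    (∫ x, (u (x + t) - u x) * conj (((W (x + t) : ℝ) : ℂ) - ((W x : ℝ) : ℂ))).re =
      ∫ x, ((u (x + t)).re - (u x).re) * (W (x + t) - W x) := by
  have h1 : MemLp (fun x ↦ u (x + t) - u x) 2 :=
    (hu.comp_measurePreserving (measurePreserving_add_right volume t)).sub hu
  have h2 : MemLp (fun x ↦ (((W (x + t) - W x : ℝ)) : ℂ)) 2 := by
    have h : MemLp (fun x ↦ ((W (x + t) : ℝ) : ℂ) - ((W x : ℝ) : ℂ)) 2 :=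
      (hW.comp_measurePreserving (measurePreserving_add_right volume t)).sub hW
    have e : (fun x ↦ (((W (x + t) - W x : ℝ)) : ℂ)) =
        fun x ↦ ((W (x + t) : ℝ) : ℂ) - ((W x : ℝ) : ℂ) := by
      funext x
      push_cast
      rfl
    rw [e]
    exact h
  have hint : Integrable (fun x ↦ (u (x + t) - u x) * (((W (x + t) - W x : ℝ)) : ℂ)) :=
    h1.integrable_mul h2
  have h := stub_supBound_re_integral_mul_conj_ofReal hint
  simp only [Complex.ofReal_sub, Complex.sub_re] at h
  exact h

/-- `‖∫ f conj(g)‖ ≤ (∫‖f‖² + ∫‖g‖²)/2` for `f, g ∈ L²` (`2|f||g| ≤ |f|² + |g|²`). [folklore] -/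
theorem stub_supBound_norm_integral_mul_conj_le {f g : ℝ → ℂ} (hf : MemLp f 2) (hg : MemLp g 2) :
    ‖∫ x, f x * conj (g x)‖ ≤ ((∫ x, ‖f x‖ ^ 2) + ∫ x, ‖g x‖ ^ 2) / 2 := by
  have hf2 : Integrable (fun x ↦ ‖f x‖ ^ 2) := (memLp_two_iff_integrable_sq_norm hf.1).1 hf
  have hg2 : Integrable (fun x ↦ ‖g x‖ ^ 2) := (memLp_two_iff_integrable_sq_norm hg.1).1 hg
  calc ‖∫ x, f x * conj (g x)‖ ≤ ∫ x, ‖f x * conj (g x)‖ := norm_integral_le_integral_norm _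
    _ ≤ ∫ x, (‖f x‖ ^ 2 + ‖g x‖ ^ 2) / 2 := by
        refine integral_mono_of_nonneg (Eventually.of_forall fun x ↦ norm_nonneg _)
          ((hf2.add hg2).div_const 2) (Eventually.of_forall fun x ↦ ?_)
        dsimp only
        rw [norm_mul, Complex.norm_conj]
        nlinarith [sq_nonneg (‖f x‖ - ‖g x‖)]
    _ = ((∫ x, ‖f x‖ ^ 2) + ∫ x, ‖g x‖ ^ 2) / 2 := by
        rw [integral_div, integral_add hf2 hg2]

/-- **The archimedean term against a real test function.** For `u, W ∈ L²` of finite energy,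
`t ↦ ρ(t) D_t(Re u, W)` is integrable on `(0, ∞)` and
`Re ∫₀^∞ ρ(t) (∫ (u(x+t) − u x) conj(W(x+t) − W x) dx) dt = ∫₀^∞ ρ(t) D_t(Re u, W) dt`
(`|∫ f conj g| ≤ (D_t(u) + D_t(W))/2` gives absolute convergence). [folklore] -/
theorem stub_supBound_arch_re {u : ℝ → ℂ} {W : ℝ → ℝ} (hu : MemLp u 2)
    (hW : MemLp (fun x ↦ (W x : ℂ)) 2)
    (hfu : IntegrableOn (fun t ↦ weilArchDensity t * weilIncrement u t) (Ioi 0))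
    (hfw : IntegrableOn (fun t ↦ weilArchDensity t * weilIncrement (fun x ↦ (W x : ℂ)) t) (Ioi 0)) :
    IntegrableOn (fun t ↦ weilArchDensity t *
        ∫ x, ((u (x + t)).re - (u x).re) * (W (x + t) - W x)) (Ioi 0) ∧
    (∫ t in Ioi (0 : ℝ), (weilArchDensity t : ℂ) *
        ∫ x, (u (x + t) - u x) * conj (((W (x + t) : ℝ) : ℂ) - ((W x : ℝ) : ℂ))).re =
      ∫ t in Ioi (0 : ℝ), weilArchDensity t *
        ∫ x, ((u (x + t)).re - (u x).re) * (W (x + t) - W x) := by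
  set F : ℝ → ℂ := fun t ↦
    ∫ x, (u (x + t) - u x) * conj (((W (x + t) : ℝ) : ℂ) - ((W x : ℝ) : ℂ)) with hF
  have hFm : AEStronglyMeasurable F volume := (stub_supBound_aesm_crossIncrement hu.1 hW.1 :)
  have hFb : ∀ t, ‖F t‖ ≤ (weilIncrement u t + weilIncrement (fun x ↦ (W x : ℂ)) t) / 2 :=
    fun t ↦ stub_supBound_norm_integral_mul_conj_le
      ((hu.comp_measurePreserving (measurePreserving_add_right volume t)).sub hu)
      ((hW.comp_measurePreserving (measurePreserving_add_right volume t)).sub hW)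
  have hInt : IntegrableOn (fun t ↦ (weilArchDensity t : ℂ) * F t) (Ioi 0) := by
    refine Integrable.mono' ((hfu.add hfw).div_const 2) ?_ ?_
    · exact (Complex.continuous_ofReal.comp_aestronglyMeasurable
        measurable_weilArchDensity.aestronglyMeasurable).mul hFm.restrict
    · refine (ae_restrict_iff' measurableSet_Ioi).2 (Eventually.of_forall fun t (ht : 0 < t) ↦ ?_)
      rw [norm_mul, Complex.norm_real, Real.norm_of_nonneg (weilArchDensity_pos ht).le]
      calc weilArchDensity t * ‖F t‖
          ≤ weilArchDensity t *
              ((weilIncrement u t + weilIncrement (fun x ↦ (W x : ℂ)) t) / 2) :=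
            mul_le_mul_of_nonneg_left (hFb t) (weilArchDensity_pos ht).le
        _ = (weilArchDensity t * weilIncrement u t +
              weilArchDensity t * weilIncrement (fun x ↦ (W x : ℂ)) t) / 2 := by ring
  have hpt : ∀ t, ((weilArchDensity t : ℂ) * F t).re =
      weilArchDensity t * ∫ x, ((u (x + t)).re - (u x).re) * (W (x + t) - W x) := fun t ↦ by
    rw [Complex.re_ofReal_mul, hF, stub_supBound_re_crossIncrement hu hW t]
  refine ⟨?_, ?_⟩
  · refine hInt.re.congr (Eventually.of_forall fun t ↦ ?_)
    show RCLike.re ((weilArchDensity t : ℂ) * F t) = _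
    rw [RCLike.re_to_complex, hpt]
  · have h := integral_re hInt
    simp only [RCLike.re_to_complex] at h
    rw [← h]
    exact integral_congr_ae (Eventually.of_forall hpt)

/-! ## The far field -/

/-- **Expansion of a real cross increment**:
`∫ (V(x+t) − V x)(W(x+t) − W x) dx = 2∫VW − ∫ W(x) V(x+t) dx − ∫ V(x) W(x+t) dx` (`V, W ∈ L²`).
[folklore] -/
theorem stub_supBound_crossIncrement_expand {V W : ℝ → ℝ} (hV : MemLp V 2) (hW : MemLp W 2)
    (t : ℝ) :
    ∫ x, (V (x + t) - V x) * (W (x + t) - W x) =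
      2 * (∫ x, V x * W x) - (∫ x, W x * V (x + t)) - ∫ x, V x * W (x + t) := by
  have hVt : MemLp (fun x ↦ V (x + t)) 2 :=
    hV.comp_measurePreserving (measurePreserving_add_right volume t)
  have hWt : MemLp (fun x ↦ W (x + t)) 2 :=
    hW.comp_measurePreserving (measurePreserving_add_right volume t)
  have i1 : Integrable (fun x ↦ V (x + t) * W (x + t)) := hVt.integrable_mul hWt
  have i2 : Integrable (fun x ↦ W x * V (x + t)) := hW.integrable_mul hVt
  have i3 : Integrable (fun x ↦ V x * W (x + t)) := hV.integrable_mul hWt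
  have i4 : Integrable (fun x ↦ V x * W x) := hV.integrable_mul hW
  have e1 : ∫ x, V (x + t) * W (x + t) = ∫ x, V x * W x :=
    integral_add_right_eq_self (fun x ↦ V x * W x) t
  have e : (fun x ↦ (V (x + t) - V x) * (W (x + t) - W x)) =
      fun x ↦ (V (x + t) * W (x + t) + V x * W x) - W x * V (x + t) - V x * W (x + t) := by
    funext x
    ring
  have i14 : Integrable (fun x ↦ V (x + t) * W (x + t) + V x * W x) := i1.add i4
  have i142 : Integrable (fun x ↦ V (x + t) * W (x + t) + V x * W x - W x * V (x + t)) :=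
    i14.sub i2
  rw [e, integral_sub i142 i3, integral_sub i14 i2, integral_add i1 i4, e1]
  ring

/-- `ρ` is bounded by `ρ(δ)` on `(δ, ∞)` (a.e. form). [folklore] -/
theorem stub_supBound_weilArchDensity_le_ae {δ : ℝ} (hδ : 0 < δ) :
    ∀ᵐ t ∂(volume.restrict (Ioi δ)), ‖weilArchDensity t‖ ≤ weilArchDensity δ := by
  refine (ae_restrict_iff' measurableSet_Ioi).2 (Eventually.of_forall fun t (ht : δ < t) ↦ ?_)
  rw [Real.norm_of_nonneg (weilArchDensity_pos (hδ.trans ht)).le]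
  exact weilArchDensity_antitoneOn (mem_Ioi.2 hδ) (mem_Ioi.2 (hδ.trans ht)) ht.le

/-- **Far-field lower bound.** For real `V, W ∈ L¹ ∩ L²` and `δ > 0`:
`(2∫_{Ioi δ} ρ) ∫VW − 2ρ(δ)‖V‖₁‖W‖₁ ≤ ∫_{Ioi δ} ρ(t) D_t(V, W) dt`. [folklore] -/
theorem stub_supBound_far_lower {V W : ℝ → ℝ} (hV : MemLp V 2) (hW : MemLp W 2)
    (hV1 : Integrable V) (hW1 : Integrable W) {δ : ℝ} (hδ : 0 < δ) :
    (2 * ∫ t in Ioi δ, weilArchDensity t) * (∫ x, V x * W x) -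
        2 * (weilArchDensity δ * ((∫ x, |V x|) * ∫ x, |W x|)) ≤
      ∫ t in Ioi δ, weilArchDensity t * ∫ x, (V (x + t) - V x) * (W (x + t) - W x) := by
  have hρ : IntegrableOn weilArchDensity (Ioi δ) := integrableOn_weilArchDensity_Ioi hδ
  have hρm : AEStronglyMeasurable weilArchDensity (volume.restrict (Ioi δ)) :=
    measurable_weilArchDensity.aestronglyMeasurable
  have hJ1 : IntegrableOn (fun t ↦ weilArchDensity t * ∫ x, W x * V (x + t)) (Ioi δ) :=
    (stub_supBound_integrable_conv hW1 hV1).integrableOn.bdd_mul hρm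
      (stub_supBound_weilArchDensity_le_ae hδ)
  have hJ2 : IntegrableOn (fun t ↦ weilArchDensity t * ∫ x, V x * W (x + t)) (Ioi δ) :=
    (stub_supBound_integrable_conv hV1 hW1).integrableOn.bdd_mul hρm
      (stub_supBound_weilArchDensity_le_ae hδ)
  have hK : IntegrableOn (fun t ↦ weilArchDensity t * (2 * ∫ x, V x * W x)) (Ioi δ) :=
    hρ.mul_const _
  have e : ∀ t, weilArchDensity t * ∫ x, (V (x + t) - V x) * (W (x + t) - W x) =
      weilArchDensity t * (2 * ∫ x, V x * W x) - weilArchDensity t * (∫ x, W x * V (x + t)) -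
        weilArchDensity t * ∫ x, V x * W (x + t) := fun t ↦ by
    rw [stub_supBound_crossIncrement_expand hV hW]
    ring
  have hKJ : IntegrableOn (fun t ↦ weilArchDensity t * (2 * ∫ x, V x * W x) -
      weilArchDensity t * ∫ x, W x * V (x + t)) (Ioi δ) := hK.sub hJ1
  simp_rw [e]
  rw [integral_sub hKJ hJ2, integral_sub hK hJ1, integral_mul_const]
  have b1 := stub_supBound_far_bound hW1 hV1 hδ
  have b2 := stub_supBound_far_bound hV1 hW1 hδ
  nlinarith [b1, b2, mul_comm (∫ x, |V x|) (∫ x, |W x|)]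

/-! ## The pole term -/

/-- `‖∫ f(x) k(x) dx‖ ≤ B ‖f‖₁` if `f` vanishes off `[-a, a]` and `|k| ≤ B` there. [folklore] -/
theorem stub_supBound_norm_integral_mul_le {f : ℝ → ℂ} {k : ℝ → ℝ} {a B : ℝ} (hf : Integrable f)
    (hf0 : ∀ x, x ∉ Icc (-a) a → f x = 0) (hk : ∀ x ∈ Icc (-a) a, |k x| ≤ B) :
    ‖∫ x, f x * (k x : ℂ)‖ ≤ B * ∫ x, ‖f x‖ := by
  rw [← integral_const_mul]
  refine norm_integral_le_of_norm_le (hf.norm.const_mul B) (Eventually.of_forall fun x ↦ ?_)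
  by_cases hx : x ∈ Icc (-a) a
  · rw [norm_mul, Complex.norm_real, Real.norm_eq_abs, mul_comm]
    exact mul_le_mul_of_nonneg_right (hk x hx) (norm_nonneg _)
  · simp [hf0 x hx]

/-- On `[-a, a] ⊆ [-A, A]`: `|cosh(x/2)| ≤ e^A` and `|sinh(x/2)| ≤ e^A`. [folklore] -/
theorem stub_supBound_cosh_sinh_le {a A x : ℝ} (haA : a ≤ A) (hx : x ∈ Icc (-a) a) :
    |Real.cosh (x / 2)| ≤ Real.exp A ∧ |Real.sinh (x / 2)| ≤ Real.exp A := by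
  have h1 : Real.exp (x / 2) ≤ Real.exp A := Real.exp_le_exp.2 (by linarith [hx.1, hx.2])
  have h2 : Real.exp (-(x / 2)) ≤ Real.exp A := Real.exp_le_exp.2 (by linarith [hx.1, hx.2])
  have h3 := Real.exp_pos (x / 2)
  have h4 := Real.exp_pos (-(x / 2))
  rw [Real.cosh_eq, Real.sinh_eq]
  constructor <;> rw [abs_le] <;> constructor <;> linarith

end Summit.RiemannHypothesis.RiemannHypothesis.Theorems.WeilWindowFlowWindowLipschitz

end
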